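import Summits.Ventures.HodgeRepro2.FaceData

/-!
# T5SignDatum — the sign arithmetic of the explicit Tier-5 datum (support for N0 / N2)

Tier 5 (README §7) discharges (N) for ONE explicit datum.  route-3's Lemma N.2 (T4N-route-3.md §3,
the datum N0 fixes) builds the two missing admissible elements from the first two by a totally
real twist: with `u ∈ F⁺^×` of signs `(+, −, +)` at the three real places `(ι₁, ι₂, ι₃)`,

  `e_{101} := u · e_{111}`,  `e_{110} := u⁻¹ · e_{100}`,

so that `e_{101} e_{110} = e_{111} e_{100} ∈ F⁺^×` exactly (equal discriminants, hence `W_A ≅ W_B`).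
This file kernel-checks the sign arithmetic behind it, in the vocabulary of p1's FaceData.lean
(`IsLiuSignElement K Φ e` = Liu's Def. 4.12 second bullet: `star e = −e`, `e ≠ 0`, and
`Im τ′(e) < 0` for every `τ′ ∈ Φ`):

* `im_mul_of_star_eq`: for a totally real `u` (`star u = u`), `Im φ(u e) = Re φ(u) · Im φ(e)` at
  every embedding `φ` — the sign of `u` at a place multiplies the sign of `e` there;
* `isLiuSignElement_mul` (THE TWIST LEMMA): `e` admissible for `Φ` ⇒ `u e` admissible for
  `twistType Φ u`, the CM type obtained from `Φ` by conjugating exactly at the places where `u < 0`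
  (`isCMType_twistType`: it is a CM type again);
* `isLiuSignElement_mul_inv`: the same for `u⁻¹` (same signs);
* `datum_101`, `datum_110`: the instantiation of T4N Lemma N.2(i) — from `e_{111}` admissible for
  `{τ₁, τ₂, τ₃}` and `e_{100}` admissible for `{τ₁, τ̄₂, τ̄₃}`, with `u` of signs `(+, −, +)`,
  `u e_{111}` is admissible for `101 = {τ₁, τ̄₂, τ₃}` and `u⁻¹ e_{100}` for `110 = {τ₁, τ₂, τ̄₃}`;
  `parityTetrahedron_zero`, `parityTetrahedron_one`, `conjCMType_parityTetrahedron_two/three`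
  identify these four sets with the vertices 111, 100 and the conjugates of 010, 001 of p1's
  `parityTetrahedron` (the odd tetrahedron of T4-B4 Prop. B4.5);
* `datum_mul_eq` / `star_mul_eq_self_of_star_eq_neg`: `(u e_{111})(u⁻¹ e_{100}) = e_{111} e_{100}`,
  a product of two trace-zero elements is fixed by conjugation (it lies in `F⁺`);
* `sq_eq_neg_mul_star`: `δ² = −δ δ̄ = −N(δ)` for a trace-zero `δ` (the «`−ee′/N(δ) ≡ −ee′ mod
  norms`» of Lemma N.2(ii)).

Nothing about hermitian spaces, Landherr's theorem or the theta correspondence is formalised.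
-/

namespace Summit.Ventures.HodgeRepro2

open NumberField ComplexEmbedding

variable {K : Type*} [Field K] [NumberField K] [NumberField.IsCMField K]

/-- Every complex embedding intertwines the conjugation `star` of the CM field `K` with complex
conjugation. -/
theorem embedding_star (φ : K →+* ℂ) (x : K) : φ (star x) = starRingEnd ℂ (φ x) :=
  NumberField.IsCMField.complexEmbedding_complexConj K φ x

/-- A totally real element (`star u = u`) has real image under every embedding. -/
theorem im_eq_zero_of_star_eq {u : K} (hu : star u = u) (φ : K →+* ℂ) : (φ u).im = 0 := by
  have h := congrArg Complex.im (embedding_star φ u)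
  rw [hu, Complex.conj_im] at h
  linarith

/-- `Im φ(u e) = Re φ(u) · Im φ(e)` for a totally real `u`: the sign of `u` at a place multiplies
the sign of `e` there. -/
theorem im_mul_of_star_eq {u : K} (hu : star u = u) (e : K) (φ : K →+* ℂ) :
    (φ (u * e)).im = (φ u).re * (φ e).im := by
  rw [map_mul, Complex.mul_im, im_eq_zero_of_star_eq hu φ, zero_mul, add_zero]

omit [NumberField K] [NumberField.IsCMField K] in
/-- The conjugate embedding takes the same real part everywhere. -/
theorem conjugate_re (u : K) (φ : K →+* ℂ) : (conjugate φ u).re = (φ u).re := by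
  rw [conjugate_coe_eq, Complex.conj_re]

omit [NumberField K] [NumberField.IsCMField K] in
/-- Conjugating an embedding twice gives it back. -/
theorem conjugate_conjugate' (φ : K →+* ℂ) : conjugate (conjugate φ) = φ :=
  RingHom.ext fun x => by rw [conjugate_coe_eq, conjugate_coe_eq, Complex.conj_conj]

/-- The real value of a totally real `u ≠ 0` is non-zero at every embedding. -/
theorem re_ne_zero_of_star_eq {u : K} (hu : star u = u) (hu0 : u ≠ 0) (φ : K →+* ℂ) :
    (φ u).re ≠ 0 := by
  intro h
  apply hu0
  apply φ.injective
  rw [map_zero]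
  exact Complex.ext h (im_eq_zero_of_star_eq hu φ)

/-- The TWIST of a CM type by the signs of a totally real element `u`: conjugate exactly at the
places where `u < 0`. -/
def twistType (Φ : Set (K →+* ℂ)) (u : K) : Set (K →+* ℂ) :=
  {φ | (φ ∈ Φ ∧ 0 < (φ u).re) ∨ (conjugate φ ∈ Φ ∧ (φ u).re < 0)}

omit [NumberField K] [NumberField.IsCMField K] in
/-- Membership in `twistType`, unfolded. -/
theorem mem_twistType_iff (Φ : Set (K →+* ℂ)) (u : K) (φ : K →+* ℂ) :
    φ ∈ twistType Φ u ↔ (φ ∈ Φ ∧ 0 < (φ u).re) ∨ (conjugate φ ∈ Φ ∧ (φ u).re < 0) := Iff.rfl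

/-- The twist of a CM type by a totally real `u ≠ 0` is a CM type. -/
theorem isCMType_twistType {Φ : Set (K →+* ℂ)} (hΦ : IsCMType K Φ) {u : K} (hu : star u = u)
    (hu0 : u ≠ 0) : IsCMType K (twistType Φ u) := by
  intro φ
  have hre := conjugate_re u φ
  have hcc : conjugate (conjugate φ) = φ := conjugate_conjugate' φ
  rcases lt_or_gt_of_ne (re_ne_zero_of_star_eq hu hu0 φ) with hneg | hpos
  · -- `u < 0` at `φ`: `φ ∈ twist ↔ conj φ ∈ Φ`, `conj φ ∈ twist ↔ φ ∈ Φ`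
    have h1 : φ ∈ twistType Φ u ↔ conjugate φ ∈ Φ := by
      rw [mem_twistType_iff]
      constructor
      · rintro (⟨_, h⟩ | ⟨h, _⟩)
        · exact absurd h (not_lt.2 hneg.le)
        · exact h
      · intro h
        exact Or.inr ⟨h, hneg⟩
    have h2 : conjugate φ ∈ twistType Φ u ↔ φ ∈ Φ := by
      rw [mem_twistType_iff, hcc, hre]
      constructor
      · rintro (⟨_, h⟩ | ⟨h, _⟩)
        · exact absurd h (not_lt.2 hneg.le)
        · exact h
      · intro h
        exact Or.inr ⟨h, hneg⟩
    rw [h1, h2]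
    exact (hΦ φ).symm
  · have h1 : φ ∈ twistType Φ u ↔ φ ∈ Φ := by
      rw [mem_twistType_iff]
      constructor
      · rintro (⟨h, _⟩ | ⟨_, h⟩)
        · exact h
        · exact absurd h (not_lt.2 hpos.le)
      · intro h
        exact Or.inl ⟨h, hpos⟩
    have h2 : conjugate φ ∈ twistType Φ u ↔ conjugate φ ∈ Φ := by
      rw [mem_twistType_iff, hcc, hre]
      constructor
      · rintro (⟨h, _⟩ | ⟨_, h⟩)
        · exact h
        · exact absurd h (not_lt.2 hpos.le)
      · intro h
        exact Or.inl ⟨h, hpos⟩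
    rw [h1, h2]
    exact hΦ φ

/-- A Liu sign element for `Φ` is one for every subset of `Φ`. -/
theorem isLiuSignElement_mono {Φ Φ' : Set (K →+* ℂ)} (h : Φ' ⊆ Φ) {e : K}
    (he : IsLiuSignElement K Φ e) : IsLiuSignElement K Φ' e :=
  ⟨he.1, he.2.1, fun φ hφ => he.2.2 φ (h hφ)⟩

/-- THE TWIST LEMMA (T4N Lemma N.2(i), the mechanism): if `e` is a Liu sign element for `Φ` and
`u ≠ 0` is totally real, then `u e` is a Liu sign element for `twistType Φ u`. -/
theorem isLiuSignElement_mul {Φ : Set (K →+* ℂ)} {e u : K} (he : IsLiuSignElement K Φ e)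
    (hu : star u = u) (hu0 : u ≠ 0) : IsLiuSignElement K (twistType Φ u) (u * e) := by
  obtain ⟨he1, he2, he3⟩ := he
  refine ⟨?_, mul_ne_zero hu0 he2, ?_⟩
  · rw [star_mul, hu, he1, neg_mul, mul_comm]
  · rintro φ (⟨hφ, hpos⟩ | ⟨hφ, hneg⟩)
    · rw [im_mul_of_star_eq hu e φ]
      exact mul_neg_of_pos_of_neg hpos (he3 φ hφ)
    · rw [im_mul_of_star_eq hu e φ]
      have h := he3 _ hφ
      rw [conjugate_coe_eq, Complex.conj_im] at h
      exact mul_neg_of_neg_of_pos hneg (by linarith)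

/-- `u⁻¹` is totally real with `u`. -/
theorem star_inv_eq {u : K} (hu : star u = u) : star u⁻¹ = u⁻¹ := by
  rw [star_inv₀, hu]

/-- `u⁻¹` has the sign of `u` at every embedding: `Re φ(u⁻¹) = (Re φ(u))⁻¹`. -/
theorem re_inv_of_star_eq {u : K} (hu : star u = u) (φ : K →+* ℂ) :
    (φ u⁻¹).re = (φ u).re⁻¹ := by
  rw [map_inv₀, Complex.inv_re, Complex.normSq_apply, im_eq_zero_of_star_eq hu φ, mul_zero,
    add_zero]
  rcases eq_or_ne (φ u).re 0 with h | h
  · rw [h, mul_zero, div_zero, inv_zero]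
  · field_simp

omit [NumberField K] [NumberField.IsCMField K] in
/-- A set of embeddings, twisted by the same signs, is the same twist. -/
theorem twistType_congr {Φ : Set (K →+* ℂ)} {u v : K}
    (h : ∀ φ : K →+* ℂ, (0 < (φ v).re ↔ 0 < (φ u).re) ∧ ((φ v).re < 0 ↔ (φ u).re < 0)) :
    twistType Φ v = twistType Φ u := by
  ext φ
  rw [mem_twistType_iff, mem_twistType_iff, (h φ).1, (h φ).2]

/-- `twistType Φ u⁻¹ = twistType Φ u` for a totally real `u`. -/
theorem twistType_inv {Φ : Set (K →+* ℂ)} {u : K} (hu : star u = u) :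
    twistType Φ u⁻¹ = twistType Φ u := by
  refine twistType_congr fun φ => ?_
  rw [re_inv_of_star_eq hu φ]
  exact ⟨inv_pos, inv_lt_zero⟩

/-- The twist lemma for `u⁻¹`: `u⁻¹ e` is admissible for `twistType Φ u` as well. -/
theorem isLiuSignElement_inv_mul {Φ : Set (K →+* ℂ)} {e u : K} (he : IsLiuSignElement K Φ e)
    (hu : star u = u) (hu0 : u ≠ 0) : IsLiuSignElement K (twistType Φ u) (u⁻¹ * e) := by
  rw [← twistType_inv hu]
  exact isLiuSignElement_mul he (star_inv_eq hu) (inv_ne_zero hu0)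

omit [NumberField K] [NumberField.IsCMField K] in
/-- `(u e)(u⁻¹ e′) = e e′` (T4N Lemma N.2(ii): equal discriminants). -/
theorem datum_mul_eq {u : K} (hu0 : u ≠ 0) (e e' : K) : (u * e) * (u⁻¹ * e') = e * e' := by
  field_simp

/-- A product of two trace-zero elements is fixed by conjugation, i.e. lies in `F⁺`. -/
theorem star_mul_eq_self_of_star_eq_neg {e e' : K} (he : star e = -e) (he' : star e' = -e') :
    star (e * e') = e * e' := by
  rw [star_mul, he, he', neg_mul_neg, mul_comm]

/-- `δ² = −δ δ̄` for a trace-zero `δ`: the determinant class `ee′/δ² = −ee′/N(δ) ≡ −ee′` modulo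
norms (Lemma N.2(ii)). -/
theorem sq_eq_neg_mul_star {δ : K} (hδ : star δ = -δ) : δ ^ 2 = -(δ * star δ) := by
  rw [hδ, mul_neg, neg_neg, sq]

section Datum

variable (τ : Fin 3 → K →+* ℂ)

omit [NumberField K] [NumberField.IsCMField K] in
/-- Vertex 0 of p1's odd tetrahedron is `111 = {τ₁, τ₂, τ₃}`. -/
theorem parityTetrahedron_zero : parityTetrahedron K τ 0 = Set.range τ := by
  ext φ
  simp [parityTetrahedron]

omit [NumberField K] [NumberField.IsCMField K] in
/-- Vertex 1 of p1's odd tetrahedron is `100 = {τ₁, τ̄₂, τ̄₃}`. -/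
theorem parityTetrahedron_one :
    parityTetrahedron K τ 1 = {τ 0, conjugate (τ 1), conjugate (τ 2)} := by
  ext φ
  simp only [parityTetrahedron, Set.mem_range, Set.mem_insert_iff, Set.mem_singleton_iff]
  constructor
  · rintro ⟨ν, rfl⟩
    fin_cases ν <;> simp
  · rintro (rfl | rfl | rfl)
    · exact ⟨0, by simp⟩
    · exact ⟨1, by simp⟩
    · exact ⟨2, by simp⟩

omit [NumberField K] [NumberField.IsCMField K] in
/-- The conjugate of vertex 2 (`010 = {τ̄₁, τ₂, τ̄₃}`) is `101 = {τ₁, τ̄₂, τ₃}`. -/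
theorem conjCMType_parityTetrahedron_two :
    conjCMType K (parityTetrahedron K τ 2) = {τ 0, conjugate (τ 1), τ 2} := by
  ext φ
  simp only [conjCMType, parityTetrahedron, Set.mem_setOf_eq, Set.mem_range, Set.mem_insert_iff,
    Set.mem_singleton_iff]
  constructor
  · rintro ⟨ν, hν⟩
    have hφ : φ = conjugate (conjugate φ) := (conjugate_conjugate' φ).symm
    fin_cases ν <;> simp at hν <;> rw [hφ, ← hν] <;> simp
  · rintro (rfl | rfl | rfl)
    · exact ⟨0, by simp⟩
    · exact ⟨1, by simp⟩
    · exact ⟨2, by simp⟩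

omit [NumberField K] [NumberField.IsCMField K] in
/-- The conjugate of vertex 3 (`001 = {τ̄₁, τ̄₂, τ₃}`) is `110 = {τ₁, τ₂, τ̄₃}`. -/
theorem conjCMType_parityTetrahedron_three :
    conjCMType K (parityTetrahedron K τ 3) = {τ 0, τ 1, conjugate (τ 2)} := by
  ext φ
  simp only [conjCMType, parityTetrahedron, Set.mem_setOf_eq, Set.mem_range, Set.mem_insert_iff,
    Set.mem_singleton_iff]
  constructor
  · rintro ⟨ν, hν⟩
    have hφ : φ = conjugate (conjugate φ) := (conjugate_conjugate' φ).symm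
    fin_cases ν <;> simp at hν <;> rw [hφ, ← hν] <;> simp
  · rintro (rfl | rfl | rfl)
    · exact ⟨0, by simp⟩
    · exact ⟨1, by simp⟩
    · exact ⟨2, by simp⟩

/-- T4N LEMMA N.2(i), first half: `e_{111}` admissible for `111 = {τ₁, τ₂, τ₃}` and `u` totally
real of signs `(+, −, +)` ⇒ `u e_{111}` is admissible for `101 = {τ₁, τ̄₂, τ₃}`. -/
theorem datum_101 {e u : K} (he : IsLiuSignElement K (Set.range τ) e) (hu : star u = u)
    (h0 : 0 < (τ 0 u).re) (h1 : (τ 1 u).re < 0) (h2 : 0 < (τ 2 u).re) :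
    IsLiuSignElement K {τ 0, conjugate (τ 1), τ 2} (u * e) := by
  have hu0 : u ≠ 0 := by
    rintro rfl
    simp at h0
  refine isLiuSignElement_mono ?_ (isLiuSignElement_mul he hu hu0)
  rintro φ (rfl | rfl | rfl)
  · exact Or.inl ⟨⟨0, rfl⟩, h0⟩
  · exact Or.inr ⟨by rw [conjugate_conjugate']; exact ⟨1, rfl⟩, by rw [conjugate_re]; exact h1⟩
  · exact Or.inl ⟨⟨2, rfl⟩, h2⟩

/-- T4N LEMMA N.2(i), second half: `e_{100}` admissible for `100 = {τ₁, τ̄₂, τ̄₃}` and the same `u`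
⇒ `u⁻¹ e_{100}` is admissible for `110 = {τ₁, τ₂, τ̄₃}`. -/
theorem datum_110 {e u : K} (he : IsLiuSignElement K {τ 0, conjugate (τ 1), conjugate (τ 2)} e)
    (hu : star u = u) (h0 : 0 < (τ 0 u).re) (h1 : (τ 1 u).re < 0) (h2 : 0 < (τ 2 u).re) :
    IsLiuSignElement K {τ 0, τ 1, conjugate (τ 2)} (u⁻¹ * e) := by
  have hu0 : u ≠ 0 := by
    rintro rfl
    simp at h0
  refine isLiuSignElement_mono ?_ (isLiuSignElement_inv_mul he hu hu0)
  rintro φ (rfl | rfl | rfl)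
  · exact Or.inl ⟨Or.inl rfl, h0⟩
  · exact Or.inr ⟨Or.inr (Or.inl rfl), h1⟩
  · exact Or.inl ⟨Or.inr (Or.inr rfl), h2⟩

/-- THE EXPLICIT DATUM of T4N Lemma N.2, assembled: from `e_{111}`, `e_{100}` and `u` of signs
`(+, −, +)`, the elements `e_{101} := u e_{111}` and `e_{110} := u⁻¹ e_{100}` are admissible for
the conjugates of the vertices `010`, `001` of p1's odd tetrahedron, and
`e_{101} e_{110} = e_{111} e_{100}` is fixed by conjugation. -/
theorem explicit_datum {e₁ e₂ u : K} (he₁ : IsLiuSignElement K (parityTetrahedron K τ 0) e₁)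
    (he₂ : IsLiuSignElement K (parityTetrahedron K τ 1) e₂) (hu : star u = u)
    (h0 : 0 < (τ 0 u).re) (h1 : (τ 1 u).re < 0) (h2 : 0 < (τ 2 u).re) :
    IsLiuSignElement K (conjCMType K (parityTetrahedron K τ 2)) (u * e₁) ∧
      IsLiuSignElement K (conjCMType K (parityTetrahedron K τ 3)) (u⁻¹ * e₂) ∧
      (u * e₁) * (u⁻¹ * e₂) = e₁ * e₂ ∧ star (e₁ * e₂) = e₁ * e₂ := by
  rw [parityTetrahedron_zero] at he₁
  rw [parityTetrahedron_one] at he₂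
  have hu0 : u ≠ 0 := by
    rintro rfl
    simp at h0
  refine ⟨?_, ?_, datum_mul_eq hu0 e₁ e₂, star_mul_eq_self_of_star_eq_neg he₁.1 he₂.1⟩
  · rw [conjCMType_parityTetrahedron_two]
    exact datum_101 τ he₁ hu h0 h1 h2
  · rw [conjCMType_parityTetrahedron_three]
    exact datum_110 τ he₂ hu h0 h1 h2

end Datum

end Summit.Ventures.HodgeRepro2
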